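import Summits.ValiantsHypothesis.ValiantsHypothesis.Theorems.BarrierLeverPartitionMinorsChowMultiEdgeStepDet
import Summits.ValiantsHypothesis.ValiantsHypothesis.Theorems.BarrierLeverPartitionMinorsChowTwoEdgeCoreEngine

/-!
# Route BarrierLever — Chow witnesses for partition minors (item 20172, CPM): the GENERAL `m`-EDGE STEP
# (a row coordinate with `m` edges against a column coordinate with `m` edges), all `m` at once

Helper file (`--supports stmt-ValiantsHypothesis-20172`; cell valiant-natproofs, rung V4, 𝒟-side of
door (c); seat val-np-p4 gen 14).  Closes NO item; imports the determinant core
`…ChowMultiEdgeStepDet` (`exists_det_multiEdge_ne_zero`) and `…ChowTwoEdgeCoreEngine` (for the lift /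
gadget lemmas `coeff_partitionExpo_mul_pairFactor`, `support_edgeGadget`, `coeff_edgeGadget`,
`support_rename_lift`, `coeff_lift_rename`, `exists_common_chow_witness₂`, `erase_eq_of_preimage_succAbove_eq`).  Conventions of items
19717 / 20172 / 20195: a layout `(u, w)` of height `h` is HIT when some product of `h + h` affine forms
has nonsingular partition minor `det[coeff_{E (u i) (w j)} ∏ ℓ]`.

**`chow_multiEdgeStep`** — the `m`-fold member of the family whose `m = 1`, `2` members are
`chow_edgeStep` (p539159) and `chow_twoEdgeStep` (p548354), in `Sum` indexing (`Fin m ⊕ Fin r`: top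
rows / columns `inl`, everything else `inr`, base rows `inr (βr l)`, base columns `inr (βc l)`): if the
reduced layout (drop the `m` tops, erase `a`, `c`) and the `m × m` base layout are hit at height `h`,
then `(u, w)` is hit at height `h + 1`; **`multiEdgeStep_of_data`** — the same from `Fin r`-indexed data
(tops `v l` anywhere, bases `β l`, erasure injective off the tops, an induction hypothesis for sizes
`≤ R`), the form an engine consumes (cf. `twoEdgeStep_of_data`); `exists_equiv_sum_of_injective` —
the re-indexing `Fin m ⊕ Fin r' ≃ Fin (m + r')` along the tops.  ENGINE CONSEQUENCE («edge-locked», now for every `m`): for a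
minimal unhit layout the EDGE-COUNT profiles `{#edges_a(U)}_a` and `{#edges_c(W)}_c` share no nonzero
value (seat census g13: `m ≥ 3` takes e.g. the `(0,0,3,3)` column profiles of the `(4,7)` residue).  A
`Fin (r + m)`-indexed layout is brought to this form by re-indexing along an equivalence
`Fin (r + m) ≃ Fin m ⊕ Fin r` (row and column equivalences may differ), which changes the partition
determinant only by a sign.

Proof: common witness for the two hypotheses (`exists_common_chow_witness₂`); its coefficient matrix
`F` on the erased layout has equal top/base rows and columns; `exists_det_multiEdge_ne_zero` gives `t`
with `det [t^{[a∈u i][c∈w j]} F i j] ≠ 0`; the lifted witness times the edge gadget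
`(1 + x_a + (1−t) y_c)(1 + t y_c)` has exactly this partition matrix (`coeff_partitionExpo_mul_pairFactor`).

WHAT THIS IS NOT: a reduction step; nothing on items 20172 / 20195 / 19717 themselves, on crux
stmt-ValiantsHypothesis-14610, or on `VP` versus `VNP`.
-/

set_option linter.dupNamespace false

namespace Summit.ValiantsHypothesis.ValiantsHypothesis.Theorems.BarrierLever.ChowFactor

open Finset MvPolynomial

noncomputable section

variable {h : ℕ}

/-! ## The layout-level `m`-edge step -/

/-- **THE `m`-EDGE STEP for Chow witnesses (all `m` at once, `Sum`-indexed).**  Height `h + 1`; the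
layout is indexed by `Fin m ⊕ Fin r`: the `m` TOP rows `inl l` carry the edge coordinate `a` and their
`a`-erasures are the BASE rows `inr (βr l)`; likewise the `m` top columns carry `c` with base columns
`inr (βc l)`.  If the REDUCED layout (rows / columns `inr _`, coordinates `a`, `c` erased and pulled
back to height `h`) and the `m × m` BASE layout (base rows × base columns, pulled back) are both hit by
products of `h + h` affine forms, then `(u, w)` is hit by a product of `(h+1) + (h+1)` affine forms.
(`m = 1`: `chow_edgeStep`; `m = 2`: `chow_twoEdgeStep`, there in `Fin (r+2)` indexing.)  Engine
consequence («edge-locked»): for a minimal unhit layout the row and column EDGE-COUNT profiles share no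
nonzero value `m`. -/
theorem chow_multiEdgeStep (a c : Fin (h + 1)) {m r : ℕ} (u w : Fin m ⊕ Fin r → Finset (Fin (h + 1)))
    (βr βc : Fin m → Fin r)
    (ha : ∀ l, a ∈ u (Sum.inl l)) (hβr : ∀ l, u (Sum.inr (βr l)) = (u (Sum.inl l)).erase a)
    (hc : ∀ l, c ∈ w (Sum.inl l)) (hβc : ∀ l, w (Sum.inr (βc l)) = (w (Sum.inl l)).erase c)
    (hred : ∃ ℓ : Fin (h + h) → MvPolynomial (Fin (h + h)) ℂ, (∀ q, (ℓ q).totalDegree ≤ 1) ∧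
      (Matrix.of fun k l : Fin r => coeff
        (∑ b ∈ (u (Sum.inr k)).preimage a.succAbove Fin.succAbove_right_injective.injOn,
            Finsupp.single (Fin.castAdd h b) 1 +
          ∑ d ∈ (w (Sum.inr l)).preimage c.succAbove Fin.succAbove_right_injective.injOn,
            Finsupp.single (Fin.natAdd h d) 1)
        (∏ q, ℓ q)).det ≠ 0)
    (hbase : ∃ ℓ : Fin (h + h) → MvPolynomial (Fin (h + h)) ℂ, (∀ q, (ℓ q).totalDegree ≤ 1) ∧
      (Matrix.of fun k l : Fin m => coeff
        (∑ b ∈ (u (Sum.inr (βr k))).preimage a.succAbove Fin.succAbove_right_injective.injOn,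
            Finsupp.single (Fin.castAdd h b) 1 +
          ∑ d ∈ (w (Sum.inr (βc l))).preimage c.succAbove Fin.succAbove_right_injective.injOn,
            Finsupp.single (Fin.natAdd h d) 1)
        (∏ q, ℓ q)).det ≠ 0) :
    ∃ ℓ : Fin ((h + 1) + (h + 1)) → MvPolynomial (Fin ((h + 1) + (h + 1))) ℂ,
      (∀ q, (ℓ q).totalDegree ≤ 1) ∧
      (Matrix.of fun i j : Fin m ⊕ Fin r => coeff
        (∑ a' ∈ u i, Finsupp.single (Fin.castAdd (h + 1) a') 1 +
          ∑ c' ∈ w j, Finsupp.single (Fin.natAdd (h + 1) c') 1)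
        (∏ q, ℓ q)).det ≠ 0 := by
  classical
  obtain ⟨ℓ, hdeg, hA, hB⟩ := exists_common_chow_witness₂ _ _ _ _ hred hbase
  -- the coefficient matrix of the (future) lifted witness on the erased layout
  set F : Matrix (Fin m ⊕ Fin r) (Fin m ⊕ Fin r) ℂ := Matrix.of fun i j => coeff
      (∑ b ∈ (u i).preimage a.succAbove Fin.succAbove_right_injective.injOn,
          Finsupp.single (Fin.castAdd h b) 1 +
        ∑ d ∈ (w j).preimage c.succAbove Fin.succAbove_right_injective.injOn,
          Finsupp.single (Fin.natAdd h d) 1) (∏ q, ℓ q) with hFdef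
  have ha0 : ∀ l, a ∉ u (Sum.inr (βr l)) := fun l => by rw [hβr]; exact Finset.notMem_erase a _
  have hc0 : ∀ l, c ∉ w (Sum.inr (βc l)) := fun l => by rw [hβc]; exact Finset.notMem_erase c _
  have hrow : ∀ l j, F (Sum.inl l) j = F (Sum.inr (βr l)) j := fun l j => by
    rw [hFdef, Matrix.of_apply, Matrix.of_apply, hβr, preimage_succAbove_erase]
  have hcol : ∀ i l, F i (Sum.inl l) = F i (Sum.inr (βc l)) := fun i l => by
    rw [hFdef, Matrix.of_apply, Matrix.of_apply, hβc, preimage_succAbove_erase]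
  have hred' : (F.submatrix Sum.inr Sum.inr).det ≠ 0 := by
    have hsub : F.submatrix Sum.inr Sum.inr = Matrix.of fun k l : Fin r => coeff
        (∑ b ∈ (u (Sum.inr k)).preimage a.succAbove Fin.succAbove_right_injective.injOn,
            Finsupp.single (Fin.castAdd h b) 1 +
          ∑ d ∈ (w (Sum.inr l)).preimage c.succAbove Fin.succAbove_right_injective.injOn,
            Finsupp.single (Fin.natAdd h d) 1)
        (∏ q, ℓ q) := by
      ext k l; rw [Matrix.submatrix_apply, hFdef, Matrix.of_apply, Matrix.of_apply]
    rw [hsub]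
    exact hA
  have hbase' : (Matrix.of fun l l' : Fin m => F (Sum.inr (βr l)) (Sum.inr (βc l'))).det ≠ 0 := by
    have e : (Matrix.of fun l l' : Fin m => F (Sum.inr (βr l)) (Sum.inr (βc l'))) =
        Matrix.of fun k l : Fin m => coeff
        (∑ b ∈ (u (Sum.inr (βr k))).preimage a.succAbove Fin.succAbove_right_injective.injOn,
            Finsupp.single (Fin.castAdd h b) 1 +
          ∑ d ∈ (w (Sum.inr (βc l))).preimage c.succAbove Fin.succAbove_right_injective.injOn,
            Finsupp.single (Fin.natAdd h d) 1)
        (∏ q, ℓ q) := by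
      ext k l; rw [Matrix.of_apply, hFdef, Matrix.of_apply, Matrix.of_apply]
    rw [e]
    exact hB
  -- the parameter
  obtain ⟨t, ht⟩ := exists_det_multiEdge_ne_zero F (fun i => a ∈ u i) (fun j => c ∈ w j) βr βc
    (fun l => ha l) (fun l => ha0 l) (fun l => hc l) (fun l => hc0 l) hrow hcol hbase' hred'
  -- the lift and the gadget (verbatim from the edge step)
  set L : Fin (h + h) → Fin ((h + 1) + (h + 1)) := Fin.append
    (fun b : Fin h => Fin.castAdd (h + 1) (a.succAbove b))
    (fun d : Fin h => Fin.natAdd (h + 1) (c.succAbove d)) with hL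
  set f₁ : MvPolynomial (Fin ((h + 1) + (h + 1))) ℂ :=
    C 1 + C 1 * X (Fin.castAdd (h + 1) a) + C (1 - t) * X (Fin.natAdd (h + 1) c) with hf₁
  set f₂ : MvPolynomial (Fin ((h + 1) + (h + 1))) ℂ :=
    C 1 + C 0 * X (Fin.castAdd (h + 1) a) + C t * X (Fin.natAdd (h + 1) c) with hf₂
  have hcard : (h + h) + 2 = (h + 1) + (h + 1) := by omega
  set e : Fin ((h + h) + 2) ≃ Fin ((h + 1) + (h + 1)) := finCongr hcard with he
  set ℓ' : Fin ((h + h) + 2) → MvPolynomial (Fin ((h + 1) + (h + 1))) ℂ :=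
    Fin.append (fun q => rename L (ℓ q)) ![f₁, f₂] with hℓ'
  refine ⟨fun q => ℓ' (e.symm q), fun q => ?_, ?_⟩
  · show (ℓ' (e.symm q)).totalDegree ≤ 1
    generalize e.symm q = q₀
    rw [hℓ']
    induction q₀ using Fin.addCases with
    | left q' =>
      rw [Fin.append_left]
      exact totalDegree_rename_le_one L (ℓ q') (hdeg q')
    | right q' =>
      rw [Fin.append_right]
      fin_cases q'
      · exact totalDegree_affine_xy_le a c 1 (1 - t)
      · exact totalDegree_affine_xy_le a c 0 t
  · have hprod : (∏ q, ℓ' (e.symm q)) = (f₁ * f₂) * rename L (∏ q, ℓ q) := by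
      rw [Fintype.prod_equiv e.symm (fun q => ℓ' (e.symm q)) ℓ' (fun _ => rfl), hℓ',
        Fin.prod_univ_add]
      simp only [Fin.append_left, Fin.append_right, Fin.prod_univ_two, Matrix.cons_val_zero,
        Matrix.cons_val_one]
      rw [map_prod, mul_comm]
    rw [hprod]
    have hentry : ∀ i j : Fin m ⊕ Fin r, coeff
        (∑ a' ∈ u i, Finsupp.single (Fin.castAdd (h + 1) a') 1 +
          ∑ c' ∈ w j, Finsupp.single (Fin.natAdd (h + 1) c') 1) ((f₁ * f₂) * rename L (∏ q, ℓ q)) =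
        (if a ∈ u i ∧ c ∈ w j then t else 1) * F i j := by
      intro i j
      rw [coeff_partitionExpo_mul_pairFactor _ _ a c (support_edgeGadget a c t)
        (support_rename_lift a c _) (u i) (w j)]
      have hfa : (u i).filter (fun a' => a' = a) = u i ∩ {a} := by
        ext x; simp [Finset.mem_filter, Finset.mem_inter]
      have hfc : (w j).filter (fun c' => c' = c) = w j ∩ {c} := by
        ext x; simp [Finset.mem_filter, Finset.mem_inter]
      rw [hfa, hfc, coeff_edgeGadget a c t _ _ ?_ ?_, erase_eq_map_preimage_succAbove,
        erase_eq_map_preimage_succAbove, coeff_lift_rename, hFdef, Matrix.of_apply]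
      · have hane : ({a} : Finset (Fin (h + 1))) ≠ ∅ := Finset.singleton_ne_empty a
        have hcne : ({c} : Finset (Fin (h + 1))) ≠ ∅ := Finset.singleton_ne_empty c
        by_cases ha' : a ∈ u i <;> by_cases hc' : c ∈ w j <;>
          simp [Finset.inter_singleton_of_mem, Finset.inter_singleton_of_notMem, ha', hc',
            hane.symm, hcne.symm]
      · by_cases ha' : a ∈ u i
        · right; rw [Finset.inter_singleton_of_mem ha']
        · left; rw [Finset.inter_singleton_of_notMem ha']
      · by_cases hc' : c ∈ w j
        · right; rw [Finset.inter_singleton_of_mem hc']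
        · left; rw [Finset.inter_singleton_of_notMem hc']
    have hM : (Matrix.of fun i j : Fin m ⊕ Fin r => coeff
        (∑ a' ∈ u i, Finsupp.single (Fin.castAdd (h + 1) a') 1 +
          ∑ c' ∈ w j, Finsupp.single (Fin.natAdd (h + 1) c') 1) ((f₁ * f₂) * rename L (∏ q, ℓ q))) =
        multiEdgeMatrix F (fun i => a ∈ u i) (fun j => c ∈ w j) t := by
      ext i j
      rw [Matrix.of_apply, hentry, multiEdgeMatrix, Matrix.of_apply]
    rw [hM]
    exact ht


/-! ## From `Fin r`-indexed data: tops anywhere, re-indexing along `Sum.elim v g` -/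

/-- An enumeration of the complement of the range of an injective `v : Fin m → Fin r` glued to `v`
gives a bijection `Fin m ⊕ Fin r' ≃ Fin r` (`r = m + r'`) sending `inl l` to `v l` and `inr` into the
complement of the range of `v`. -/
theorem exists_equiv_sum_of_injective {m r' : ℕ} (v : Fin m → Fin (m + r')) (hv : Function.Injective v) :
    ∃ e : Fin m ⊕ Fin r' ≃ Fin (m + r'), (∀ l, e (Sum.inl l) = v l) ∧ ∀ k l, e (Sum.inr k) ≠ v l := by
  classical
  set S : Finset (Fin (m + r')) := Finset.univ \ Finset.univ.image v with hS
  have hcard : S.card = r' := by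
    rw [hS, Finset.card_sdiff_of_subset (Finset.subset_univ _), Finset.card_univ, Fintype.card_fin,
      Finset.card_image_of_injective _ hv, Finset.card_univ, Fintype.card_fin]
    omega
  set g : Fin r' → Fin (m + r') := fun k => S.orderEmbOfFin hcard k with hg
  have hgS : ∀ k, g k ∈ S := fun k => Finset.orderEmbOfFin_mem S hcard k
  have hg_inj : Function.Injective g := fun k k' e => (S.orderEmbOfFin hcard).injective e
  have hgv : ∀ k l, g k ≠ v l := by
    intro k l e
    have hk := hgS k
    rw [hS, Finset.mem_sdiff] at hk
    exact hk.2 (Finset.mem_image.mpr ⟨l, Finset.mem_univ _, e.symm⟩)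
  set f : Fin m ⊕ Fin r' → Fin (m + r') := Sum.elim v g with hf
  have hf_inj : Function.Injective f := by
    rintro (l | k) (l' | k') e
    · exact congrArg Sum.inl (hv e)
    · exact absurd e.symm (hgv k' l)
    · exact absurd e (hgv k l')
    · exact congrArg Sum.inr (hg_inj e)
  have hf_bij : Function.Bijective f := by
    refine (Fintype.bijective_iff_injective_and_card f).mpr ⟨hf_inj, ?_⟩
    simp [Fintype.card_sum, Fintype.card_fin]
  exact ⟨Equiv.ofBijective f hf_bij, fun l => rfl, fun k l => hgv k l⟩

/-- **The `m`-edge step from `Fin r`-indexed data** (the form the engine consumes).  Tops `v l`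
(`a ∈ u (v l)`, injective `v`), bases `β l` with `u (β l) = (u (v l)).erase a`, likewise for the
columns; the `a`-erasure is injective OFF the tops, the `c`-erasure injective off the column tops;
`1 ≤ m` and `r ≤ R + 1`; an induction hypothesis `ih` hitting every injective layout of size `≤ R` at
every height supplies the reduced layout (size `r − m ≤ R`) and the base layout (size `m ≤ R`, because
the base rows are not tops).  Conclusion: `(u, w)` is hit. -/
theorem multiEdgeStep_of_data {h r R m : ℕ}
    (ih : ∀ (h r : ℕ), r ≤ R → ∀ (u w : Fin r → Finset (Fin h)), Function.Injective u →
      Function.Injective w →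
      ∃ ℓ : Fin (h + h) → MvPolynomial (Fin (h + h)) ℂ, (∀ q, (ℓ q).totalDegree ≤ 1) ∧
        (Matrix.of fun i j : Fin r => coeff
          (∑ b ∈ u i, Finsupp.single (Fin.castAdd h b) 1 + ∑ d ∈ w j, Finsupp.single (Fin.natAdd h d) 1)
          (∏ q, ℓ q)).det ≠ 0)
    (u w : Fin r → Finset (Fin h)) (hu : Function.Injective u) (hw : Function.Injective w)
    (hrR : r ≤ R + 1) (a c : Fin h) (hm : 1 ≤ m) (v β j γ : Fin m → Fin r) (hv : Function.Injective v)
    (hj : Function.Injective j)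
    (ha : ∀ l, a ∈ u (v l)) (hβ : ∀ l, u (β l) = (u (v l)).erase a)
    (hc : ∀ l, c ∈ w (j l)) (hγ : ∀ l, w (γ l) = (w (j l)).erase c)
    (hinju : Set.InjOn (fun i => (u i).erase a) {i | ∀ l, i ≠ v l})
    (hinjw : Set.InjOn (fun j' => (w j').erase c) {j' | ∀ l, j' ≠ j l}) :
    ∃ ℓ : Fin (h + h) → MvPolynomial (Fin (h + h)) ℂ, (∀ q, (ℓ q).totalDegree ≤ 1) ∧
      (Matrix.of fun i j : Fin r => coeff
        (∑ b ∈ u i, Finsupp.single (Fin.castAdd h b) 1 + ∑ d ∈ w j, Finsupp.single (Fin.natAdd h d) 1)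
        (∏ q, ℓ q)).det ≠ 0 := by
  classical
  obtain ⟨h'', rfl⟩ : ∃ h'', h = h'' + 1 := ⟨h - 1, by have := a.pos; omega⟩
  -- base rows are not tops, so there are at least `m + 1` rows: `m ≤ R` and `r ≤ R + m`
  have hβv0 : ∀ l l', β l ≠ v l' := fun l l' e => by
    have := ha l'; rw [← e, hβ] at this; exact Finset.notMem_erase a _ this
  have hmr : m + 1 ≤ r := by
    have hinj : Function.Injective (fun o : Option (Fin m) => o.elim (β ⟨0, hm⟩) v) := by
      rintro (_ | l) (_ | l') e
      · rfl
      · exact absurd e (hβv0 _ l')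
      · exact absurd e.symm (hβv0 _ l)
      · exact congrArg some (hv e)
    simpa [Fintype.card_option] using Fintype.card_le_of_injective _ hinj
  have hmR : m ≤ R := by omega
  obtain ⟨r', rfl⟩ : ∃ r', r = m + r' := ⟨r - m, by omega⟩
  obtain ⟨er, her, herv⟩ := exists_equiv_sum_of_injective v hv
  obtain ⟨ec, hec, hecj⟩ := exists_equiv_sum_of_injective j hj
  -- base rows / columns are not tops
  have hβv : ∀ l l', β l ≠ v l' := fun l l' e => by
    have := ha l'; rw [← e, hβ] at this; exact Finset.notMem_erase a _ this
  have hγj : ∀ l l', γ l ≠ j l' := fun l l' e => by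
    have := hc l'; rw [← e, hγ] at this; exact Finset.notMem_erase c _ this
  -- pull the bases back along the equivalences: they are `inr`
  have hβinr : ∀ l, ∃ k, er (Sum.inr k) = β l := fun l => by
    rcases hx : er.symm (β l) with l' | k
    · exact absurd ((congrArg er hx).symm.trans (er.apply_symm_apply _) |>.symm.trans (her l')) (hβv l l')
    · exact ⟨k, by rw [← hx, er.apply_symm_apply]⟩
  have hγinr : ∀ l, ∃ k, ec (Sum.inr k) = γ l := fun l => by
    rcases hx : ec.symm (γ l) with l' | k
    · exact absurd ((congrArg ec hx).symm.trans (ec.apply_symm_apply _) |>.symm.trans (hec l')) (hγj l l')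
    · exact ⟨k, by rw [← hx, ec.apply_symm_apply]⟩
  choose βr hβr using hβinr
  choose βc hβc using hγinr
  set u' : Fin m ⊕ Fin r' → Finset (Fin (h'' + 1)) := fun i => u (er i) with hu'
  set w' : Fin m ⊕ Fin r' → Finset (Fin (h'' + 1)) := fun i => w (ec i) with hw'
  -- the hypotheses of the Sum-indexed step
  have ha' : ∀ l, a ∈ u' (Sum.inl l) := fun l => by rw [hu']; show a ∈ u (er (Sum.inl l)); rw [her]; exact ha l
  have hβ' : ∀ l, u' (Sum.inr (βr l)) = (u' (Sum.inl l)).erase a := fun l => by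
    show u (er (Sum.inr (βr l))) = (u (er (Sum.inl l))).erase a
    rw [hβr, her, hβ]
  have hc' : ∀ l, c ∈ w' (Sum.inl l) := fun l => by rw [hw']; show c ∈ w (ec (Sum.inl l)); rw [hec]; exact hc l
  have hγ' : ∀ l, w' (Sum.inr (βc l)) = (w' (Sum.inl l)).erase c := fun l => by
    show w (ec (Sum.inr (βc l))) = (w (ec (Sum.inl l))).erase c
    rw [hβc, hec, hγ]
  -- reduced layout: injective (injOn off the tops + pull-back)
  have hred_inj_u : Function.Injective fun k : Fin r' =>
      (u' (Sum.inr k)).preimage a.succAbove Fin.succAbove_right_injective.injOn := by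
    intro k k' hkk
    have he := erase_eq_of_preimage_succAbove_eq a hkk
    have h1 : er (Sum.inr k) ∈ {i | ∀ l, i ≠ v l} := fun l => herv k l
    have h2 : er (Sum.inr k') ∈ {i | ∀ l, i ≠ v l} := fun l => herv k' l
    have := hinju h1 h2 he
    exact Sum.inr_injective (er.injective this)
  have hred_inj_w : Function.Injective fun k : Fin r' =>
      (w' (Sum.inr k)).preimage c.succAbove Fin.succAbove_right_injective.injOn := by
    intro k k' hkk
    have he := erase_eq_of_preimage_succAbove_eq c hkk
    have h1 : ec (Sum.inr k) ∈ {j' | ∀ l, j' ≠ j l} := fun l => hecj k l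
    have h2 : ec (Sum.inr k') ∈ {j' | ∀ l, j' ≠ j l} := fun l => hecj k' l
    have := hinjw h1 h2 he
    exact Sum.inr_injective (ec.injective this)
  -- base layout: injective
  have hbase_inj_u : Function.Injective fun l : Fin m =>
      (u' (Sum.inr (βr l))).preimage a.succAbove Fin.succAbove_right_injective.injOn := by
    intro l l' hll
    have he := erase_eq_of_preimage_succAbove_eq a hll
    rw [hβ', hβ', Finset.erase_idem, Finset.erase_idem] at he
    have huv : u' (Sum.inl l) = u' (Sum.inl l') := by
      rw [← Finset.insert_erase (ha' l), ← Finset.insert_erase (ha' l'), he]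
    have : er (Sum.inl l) = er (Sum.inl l') := hu huv
    exact Sum.inl_injective (er.injective this)
  have hbase_inj_w : Function.Injective fun l : Fin m =>
      (w' (Sum.inr (βc l))).preimage c.succAbove Fin.succAbove_right_injective.injOn := by
    intro l l' hll
    have he := erase_eq_of_preimage_succAbove_eq c hll
    rw [hγ', hγ', Finset.erase_idem, Finset.erase_idem] at he
    have hwv : w' (Sum.inl l) = w' (Sum.inl l') := by
      rw [← Finset.insert_erase (hc' l), ← Finset.insert_erase (hc' l'), he]
    have : ec (Sum.inl l) = ec (Sum.inl l') := hw hwv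
    exact Sum.inl_injective (ec.injective this)
  -- the Sum-indexed step
  obtain ⟨ℓ, hdeg, hdet⟩ := chow_multiEdgeStep a c u' w' βr βc ha' hβ' hc' hγ'
    (ih h'' r' (by omega) _ _ hred_inj_u hred_inj_w) (ih h'' m hmR _ _ hbase_inj_u hbase_inj_w)
  refine ⟨ℓ, hdeg, ?_⟩
  -- transport the determinant back along the equivalences
  set M : Matrix (Fin (m + r')) (Fin (m + r')) ℂ := Matrix.of fun i j => coeff
      (∑ b ∈ u i, Finsupp.single (Fin.castAdd (h'' + 1) b) 1 +
        ∑ d ∈ w j, Finsupp.single (Fin.natAdd (h'' + 1) d) 1) (∏ q, ℓ q) with hM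
  have hsub : (Matrix.of fun i j : Fin m ⊕ Fin r' => coeff
      (∑ a' ∈ u' i, Finsupp.single (Fin.castAdd (h'' + 1) a') 1 +
        ∑ c' ∈ w' j, Finsupp.single (Fin.natAdd (h'' + 1) c') 1) (∏ q, ℓ q)) =
      (M.submatrix er er).submatrix id (ec.trans er.symm) := by
    ext i j
    simp only [Matrix.submatrix_apply, hM, Matrix.of_apply, id, Equiv.trans_apply,
      Equiv.apply_symm_apply, hu', hw']
  intro h0
  apply hdet
  rw [hsub, Matrix.det_permute', Matrix.det_submatrix_equiv_self]
  show ((Equiv.Perm.sign (ec.trans er.symm) : ℤ) : ℂ) * M.det = 0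
  rw [show M.det = 0 from h0, mul_zero]

end

end Summit.ValiantsHypothesis.ValiantsHypothesis.Theorems.BarrierLever.ChowFactor
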